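import Literature.Geometry.Lorentzian.WeakSolutionRegularity
import Literature.Geometry.Lorentzian.GreenIdentity
import Literature.Geometry.Lorentzian.EnergyCurrents
import Literature.Geometry.Lorentzian.DalembertianCompose
import Literature.Geometry.Lorentzian.HopfPositivity
import Literature.Analysis.Distribution.EllipticRegularityProofs
import HarnessLib

/-!
# `L²`-coercive Schrödinger operators `−Δ_h + V` on a closed Riemannian manifold:
# smooth solvability of `−Δ_h u + V u = f`, nonnegativity for `f ≥ 0`, and a positive smooth
# strict supersolution (`λ₁ > 0 ⇒ ∃ u > 0, (−Δ_h + V) u > 0`)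

On a closed (compact, boundaryless, Hausdorff) smooth manifold `M` modelled on `ℝ^m`, `m ≥ 1`,
with a smooth Riemannian metric `h` (Mathlib's `ContMDiffRiemannianMetric`; Laplace–Beltrami
operator `Δ_h = tr_h Hess` = `(ofRiemannian h).dalembertian`, gradient square
`h⁻¹(du, du)` = `gradSq`, Riemannian measure `dV_h = riemannianMeasure h`), let `V` be a
continuous potential whose Schrödinger form is **coercive on `C¹(M)`**:
`c ∫ w² dV_h ≤ ∫ (h⁻¹(dw, dw) + V w²) dV_h` for all `w ∈ C¹(M)`, `c > 0` (the bottom of the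
spectrum of `−Δ_h + V` is positive). Everything below is PROVED; the file introduces no
definition and no statement of `Prop` type.

* `exists_veryWeakSolution_schrodinger_of_coercive` — for continuous `V, f` there is
  `U ∈ L²(dV_h)` with `∫ U (Δ_h ζ − V ζ) dV_h = −∫ f ζ dV_h` for all `ζ ∈ C²(M)`: the Riesz /
  Lax–Milgram theorem (`exists_cauchySeq_tendsto_of_coercive`, `AFLinearWeakExistence.lean`;
  Gilbarg–Trudinger 2001, Thm. 5.8) on the completion of `C²(M)` for the energy inner product
  `⟨φ, ψ⟩ = ∫ (h⁻¹(dφ, dψ) + V φ ψ) dV_h`, the functional `ψ ↦ ∫ f ψ` being bounded through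
  `L²` (Mathlib's `Lp ℝ 2`); the Cauchy sequence of test functions converges in `L²` and Green's
  identity on the closed manifold (`integral_mul_dalembertian_eq_neg_integral_innerDual`,
  `GreenIdentity.lean`) yields the distributional equation.
* `exists_smooth_solution_schrodinger_of_coercive` — for smooth `V, f` there is `u ∈ C^∞(M)` with
  `−Δ_h u + V u = f`: interior regularity (`exists_contMDiffOn_ae_eq_of_veryWeak`,
  `WeakSolutionRegularity.lean`, with Folland 1995, Cor. (6.34), PROVED in this tree as
  `Folland1995_cor634_holds`), patching and `dalembertian_sub_mul_eq_of_veryWeak`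
  (Gilbarg–Trudinger 2001, Thm. 8.3 with Cor. 8.11, on a closed manifold).
* `nonneg_of_schrodinger_eq_of_coercive` — a `C²` solution of `−Δ_h u + V u = f` with `f ≥ 0`
  is `≥ 0` (weak minimum principle from coercivity, by Stampacchia truncation: the coercivity
  tested on `η_ε(u)`, `η_ε(s) = (√(s² + ε²) − s)/2` a smooth convex regularisation of `s⁻`, and
  the equation tested on `η_ε(u) η_ε'(u) ≤ 0` give `∫ (u⁻)² ≤ ε² ∫V²/(4c²)` for all `ε > 0`;
  Gilbarg–Trudinger 2001, Thm. 8.1). The elementary properties of `η_ε` are `truncation_facts`.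
* `pos_of_schrodinger_eq_of_nonneg` — if moreover `f > 0` then `u > 0` (E. Hopf's local strong
  minimum principle `dalembertian_supersolution_eventually_eq`, `HopfPositivity.lean`,
  López-Gómez 2012, Thm. 1.2).
* `exists_pos_smooth_supersolution_of_coercive` — **there is a smooth `u > 0` with
  `−Δ_h u + V u > 0` everywhere**: smooth `Ṽ` with `V − c/2 ≤ Ṽ ≤ V` (smooth partitions of
  unity, Mathlib's `exists_contMDiffMap_forall_mem_convex_of_local_const`), solve
  `−Δ_h u + Ṽ u = 1` smoothly, `u > 0` by the two previous results, and
  `−Δ_h u + V u = 1 + (V − Ṽ) u ≥ 1`. This is the implication "first eigenvalue positive ⇒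
  positive (super)solution" used for conformal Laplacians by Kazdan–Warner and by
  Gursky–LeBrun 1998, Prop. 3 / Chen–Zhu 2014, Cor. 2.2 (`σ`-modified conformal Laplacian
  `−6Δ + σ`); it is the analytic half of the proof of the named fact
  `Literature.Geometry.Riemannian.chenZhu_conformalPic_of_isotropicFormPos`
  (`ChenZhuConformalPic.lean`), whose geometric half is `ConformalIsotropicCurvature.lean`.

Design. The metric is a `ContMDiffRiemannianMetric` `h` with `[(ofRiemannian h).HasLeviCivita]`
(the setting of `GreenIdentity.lean` / `WeakSolutionRegularity.lean`; for a Riemannian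
`PseudoRiemannianMetric` `G` take `h = G.toContMDiffRiemannianMetric hG`, for which
`ofRiemannian h = G` definitionally). Test functions are `C¹`/`C²` exactly as the route item
`ConformalPic` of `SmoothPoincare4/IsotropicCorkBracketing` states its hypothesis. `m ≥ 1` is
needed only for the regularity theorem (`Nontrivial (ℝ^m)`).

## References

* D. Gilbarg, N. S. Trudinger, *Elliptic Partial Differential Equations of Second Order*,
  Springer 2001, Thm. 5.8 (Lax–Milgram), Thm. 8.1 (weak maximum principle), Thm. 8.3
  (solvability), Cor. 8.11 (interior regularity), Thm. 3.5 (strong maximum principle).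
  [GilbargTrudinger2001]
* G. B. Folland, *Introduction to Partial Differential Equations*, 2nd ed. (1995), Cor. (6.34).
  [Folland2020]
* J. López-Gómez, *Linear Second Order Elliptic Operators*, World Scientific 2013, Thm. 1.2.
  [LopezGomez2012]
* M. J. Gursky, C. LeBrun, *Yamabe invariants and spinᶜ structures*, GAFA 8 (1998) 965–977,
  Prop. 3. [GurskyLebrun1998]
* B.-L. Chen, X.-P. Zhu, Comm. Anal. Geom. 22 (2014) 811–831, Cor. 2.2. [ChenZhu2014]
-/

noncomputable section

open Set Function Filter Topology MeasureTheory Measure TopologicalSpace Manifold Bundle Module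
  UniformSpace InnerProductSpace
open scoped Manifold ContDiff ENNReal RealInnerProductSpace

namespace Literature.Geometry.Riemannian

open Lorentzian Lorentzian.PseudoRiemannianMetric

section Existence

variable {m : ℕ} {M : Type*} [TopologicalSpace M] [T2Space M] [CompactSpace M]
  [ChartedSpace (EuclideanSpace ℝ (Fin m)) M] [IsManifold (𝓡 m) ∞ M]
  [MeasurableSpace M] [BorelSpace M]
  (h : ContMDiffRiemannianMetric (𝓡 m) ∞ (EuclideanSpace ℝ (Fin m)) (TangentSpace (𝓡 m) : M → Type _))
  [(ofRiemannian h).HasLeviCivita]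

/-- **Weak solvability of an `L²`-coercive Schrödinger equation on a closed manifold.** Let
`(M, h)` be a closed Riemannian manifold, `V, f` continuous, and suppose the quadratic form of
`−Δ_h + V` is coercive on `C¹(M)`: `c ∫ u² dV_h ≤ ∫ (h⁻¹(du, du) + V u²) dV_h` with `c > 0`. Then
there is `U ∈ L²(M, dV_h)` with `∫ U (Δ_h ζ − V ζ) dV_h = −∫ f ζ dV_h` for every `ζ ∈ C²(M)`,
i.e. a distributional solution of `−Δ_h U + V U = f`. Proof: the Lax–Milgram / Riesz theorem
(`exists_cauchySeq_tendsto_of_coercive`, Gilbarg–Trudinger 2001, Thm. 5.8) on the completion of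
`C²(M)` for the inner product `⟨φ, ψ⟩ = ∫ (h⁻¹(dφ, dψ) + V φ ψ) dV_h` (positive definite by
coercivity), the functional `ψ ↦ ∫ f ψ dV_h` being bounded through `L²`; the minimizing Cauchy
sequence converges in `L²` and Green's identity `∫ h⁻¹(dv, dζ) dV_h = −∫ v Δ_h ζ dV_h`
(`integral_mul_dalembertian_eq_neg_integral_innerDual`) gives the distributional equation.
(Gilbarg–Trudinger 2001, Thm. 5.8 and §8.2, Thm. 8.3, on a closed manifold.)
[cite: GilbargTrudinger2001, Thm. 5.8 and Thm. 8.3] -/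
theorem exists_veryWeakSolution_schrodinger_of_coercive {V f : M → ℝ} (hV : Continuous V)
    (hf : Continuous f) {c : ℝ} (hc : 0 < c)
    (hcoer : ∀ u : M → ℝ, ContMDiff (𝓡 m) 𝓘(ℝ, ℝ) 1 u →
      c * ∫ x, u x ^ 2 ∂riemannianMeasure h ≤
        ∫ x, ((ofRiemannian h).gradSq u x + V x * u x ^ 2) ∂riemannianMeasure h) :
    ∃ U : M → ℝ, MemLp U 2 (riemannianMeasure h) ∧
      ∀ ζ : M → ℝ, ContMDiff (𝓡 m) 𝓘(ℝ, ℝ) 2 ζ →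
        ∫ x, U x * ((ofRiemannian h).dalembertian ζ x - V x * ζ x) ∂riemannianMeasure h =
          ∫ x, (-f x) * ζ x ∂riemannianMeasure h := by
  classical
  set g := ofRiemannian h with hg_def
  set μ : Measure M := riemannianMeasure h with hμ
  haveI : IsFiniteMeasure μ := isFiniteMeasure_riemannianMeasure h
  haveI : μ.IsOpenPosMeasure := isOpenPosMeasure_riemannianMeasure h
  have hcs : ∀ F : M → ℝ, HasCompactSupport F := fun F ↦
    IsCompact.of_isClosed_subset isCompact_univ (isClosed_tsupport F) (subset_univ _)
  /- the pairing `P u w = ∫ (h⁻¹(du, dw) + V u w) dV` -/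
  obtain ⟨P, hP⟩ : ∃ P : (M → ℝ) → (M → ℝ) → ℝ, ∀ u w, P u w =
      ∫ x, (g.innerDual x (mvfderiv (𝓡 m) u x).toLinearMap (mvfderiv (𝓡 m) w x).toLinearMap
        + V x * u x * w x) ∂μ := ⟨_, fun _ _ ↦ rfl⟩
  have hIcont : ∀ {u w : M → ℝ}, ContMDiff (𝓡 m) 𝓘(ℝ, ℝ) 1 u → ContMDiff (𝓡 m) 𝓘(ℝ, ℝ) 1 w →
      Continuous fun x ↦ g.innerDual x (mvfderiv (𝓡 m) u x).toLinearMap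
        (mvfderiv (𝓡 m) w x).toLinearMap := fun hu hw ↦ continuous_innerDual_mvfderiv g hu hw
  have hIint : ∀ {u w : M → ℝ}, ContMDiff (𝓡 m) 𝓘(ℝ, ℝ) 1 u → ContMDiff (𝓡 m) 𝓘(ℝ, ℝ) 1 w →
      Integrable (fun x ↦ g.innerDual x (mvfderiv (𝓡 m) u x).toLinearMap
        (mvfderiv (𝓡 m) w x).toLinearMap) μ := fun hu hw ↦
    integrable_of_continuous h (hIcont hu hw)
  have hPint : ∀ {u w : M → ℝ}, ContMDiff (𝓡 m) 𝓘(ℝ, ℝ) 1 u → ContMDiff (𝓡 m) 𝓘(ℝ, ℝ) 1 w →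
      Integrable (fun x ↦ g.innerDual x (mvfderiv (𝓡 m) u x).toLinearMap
        (mvfderiv (𝓡 m) w x).toLinearMap + V x * u x * w x) μ := fun hu hw ↦
    integrable_of_continuous h ((hIcont hu hw).add ((hV.mul hu.continuous).mul hw.continuous))
  have hPcomm : ∀ u w, P u w = P w u := fun u w ↦ by
    rw [hP, hP]
    refine integral_congr_ae (Eventually.of_forall fun x ↦ ?_)
    simp only
    rw [g.innerDual_comm x]
    ring
  have hPadd : ∀ {u v w : M → ℝ}, ContMDiff (𝓡 m) 𝓘(ℝ, ℝ) 1 u → ContMDiff (𝓡 m) 𝓘(ℝ, ℝ) 1 v →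
      ContMDiff (𝓡 m) 𝓘(ℝ, ℝ) 1 w → P (u + v) w = P u w + P v w := by
    intro u v w hu hv hw
    rw [hP, hP, hP, ← integral_add (hPint hu hw) (hPint hv hw)]
    refine integral_congr_ae (Eventually.of_forall fun x ↦ ?_)
    simp only [Pi.add_apply]
    rw [mvfderiv_add ((hu x).mdifferentiableAt one_ne_zero) ((hv x).mdifferentiableAt one_ne_zero)]
    simp only [ContinuousLinearMap.toLinearMap_add, PseudoRiemannianMetric.innerDual,
      LinearMap.add_apply]
    ring
  have hPsmul : ∀ {u w : M → ℝ} (a : ℝ), ContMDiff (𝓡 m) 𝓘(ℝ, ℝ) 1 u →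
      P (a • u) w = a * P u w := by
    intro u w a hu
    rw [hP, hP, ← integral_const_mul]
    refine integral_congr_ae (Eventually.of_forall fun x ↦ ?_)
    have hd : mvfderiv (𝓡 m) (a • u) x = a • mvfderiv (𝓡 m) u x := by
      ext v
      simp [mvfderiv, const_smul_mfderiv ((hu x).mdifferentiableAt one_ne_zero) a]
      rfl
    simp only [Pi.smul_apply, smul_eq_mul, hd, ContinuousLinearMap.toLinearMap_smul,
      PseudoRiemannianMetric.innerDual, LinearMap.smul_apply]
    ring
  have hPcoer : ∀ {u : M → ℝ}, ContMDiff (𝓡 m) 𝓘(ℝ, ℝ) 1 u → c * ∫ x, u x ^ 2 ∂μ ≤ P u u := by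
    intro u hu
    rw [hP]
    have h1 := hcoer u hu
    have heq : ∫ x, (g.gradSq u x + V x * u x ^ 2) ∂μ = ∫ x, (g.innerDual x
        (mvfderiv (𝓡 m) u x).toLinearMap (mvfderiv (𝓡 m) u x).toLinearMap + V x * u x * u x) ∂μ := by
      refine integral_congr_ae (Eventually.of_forall fun x ↦ ?_)
      simp only [PseudoRiemannianMetric.gradSq]
      ring
    rw [← heq]
    exact h1
  have hsq_int : ∀ {u : M → ℝ}, Continuous u → Integrable (fun x ↦ u x ^ 2) μ := fun hu ↦
    integrable_of_continuous h (hu.pow 2)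
  /- the test space `W = C²(M)` -/
  obtain ⟨W, hW⟩ : ∃ W : Submodule ℝ (ContMDiffMap (𝓡 m) 𝓘(ℝ, ℝ) M ℝ 2),
      ∀ φ : ContMDiffMap (𝓡 m) 𝓘(ℝ, ℝ) M ℝ 2, φ ∈ W := ⟨⊤, fun _ ↦ trivial⟩
  obtain ⟨ev, hev⟩ : ∃ ev : W → M → ℝ, ∀ φ, ev φ = ⇑(φ : ContMDiffMap (𝓡 m) 𝓘(ℝ, ℝ) M ℝ 2) :=
    ⟨_, fun _ ↦ rfl⟩
  have hev2 : ∀ φ : W, ContMDiff (𝓡 m) 𝓘(ℝ, ℝ) 2 (ev φ) := fun φ ↦ by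
    rw [hev]; exact (φ : ContMDiffMap (𝓡 m) 𝓘(ℝ, ℝ) M ℝ 2).contMDiff
  have hev1 : ∀ φ : W, ContMDiff (𝓡 m) 𝓘(ℝ, ℝ) 1 (ev φ) := fun φ ↦ (hev2 φ).of_le one_le_two
  have hevcont : ∀ φ : W, Continuous (ev φ) := fun φ ↦ (hev2 φ).continuous
  have hev_add : ∀ φ ψ : W, ev (φ + ψ) = ev φ + ev ψ := fun φ ψ ↦ by rw [hev, hev, hev]; rfl
  have hev_smul : ∀ (a : ℝ) (φ : W), ev (a • φ) = a • ev φ := fun a φ ↦ by rw [hev, hev]; rfl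
  have hev_sub : ∀ φ ψ : W, ev (φ - ψ) = ev φ - ev ψ := fun φ ψ ↦ by rw [hev, hev, hev]; rfl
  have hev_zero : ev 0 = 0 := by rw [hev]; rfl
  have hev_inj : ∀ φ ψ : W, ev φ = ev ψ → φ = ψ := fun φ ψ hφψ ↦ by
    rw [hev, hev] at hφψ
    exact Subtype.ext (DFunLike.coe_injective hφψ)
  have hev_mk : ∀ ζ : M → ℝ, ContMDiff (𝓡 m) 𝓘(ℝ, ℝ) 2 ζ → ∃ φ : W, ev φ = ζ := fun ζ hζ ↦
    ⟨⟨⟨ζ, hζ⟩, hW _⟩, by rw [hev]; rfl⟩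
  /- the energy inner product on `W` -/
  have hip_def : ∀ φ : W, P (ev φ) (ev φ) = 0 → φ = 0 := by
    intro φ h0
    have h1 : c * ∫ x, ev φ x ^ 2 ∂μ ≤ 0 := by rw [← h0]; exact hPcoer (hev1 φ)
    have h2 : ∫ x, ev φ x ^ 2 ∂μ ≤ 0 := by
      by_contra hlt
      linarith [mul_pos hc (not_le.1 hlt)]
    have h3 : ∫ x, ev φ x ^ 2 ∂μ = 0 := le_antisymm h2 (integral_nonneg fun x ↦ sq_nonneg _)
    have hae := (integral_eq_zero_iff_of_nonneg (fun x ↦ sq_nonneg _) (hsq_int (hevcont φ))).1 h3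
    have hfun : (fun x ↦ ev φ x ^ 2) = fun _ ↦ (0 : ℝ) :=
      (Continuous.ae_eq_iff_eq μ ((hevcont φ).pow 2) continuous_const).1 hae
    apply hev_inj
    rw [hev_zero]
    funext x
    have hx := congr_fun hfun x
    simpa using hx
  obtain ⟨core, hcore⟩ : ∃ core : InnerProductSpace.Core ℝ W,
      ∀ φ ψ, core.inner φ ψ = P (ev φ) (ev ψ) :=
    ⟨{ inner := fun φ ψ ↦ P (ev φ) (ev ψ)
       conj_inner_symm := fun φ ψ ↦ by simp [hPcomm (ev φ) (ev ψ)]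
       re_inner_nonneg := fun φ ↦ by
         have h1 := hPcoer (hev1 φ)
         have h2 : 0 ≤ ∫ x, ev φ x ^ 2 ∂μ := integral_nonneg fun x ↦ sq_nonneg _
         simpa using h1.trans' (by positivity)
       add_left := fun φ ψ χ ↦ by
         rw [hev_add]; exact hPadd (hev1 φ) (hev1 ψ) (hev1 χ)
       smul_left := fun φ ψ r ↦ by
         simpa [hev_smul] using hPsmul r (hev1 φ) (w := ev ψ)
       definite := hip_def }, fun _ _ ↦ rfl⟩
  letI i1 : NormedAddCommGroup W := @InnerProductSpace.Core.toNormedAddCommGroup ℝ W _ _ _ core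
  letI i2 : InnerProductSpace ℝ W := InnerProductSpace.ofCore core.toCore
  have hinner : ∀ φ ψ : W, ⟪φ, ψ⟫ = P (ev φ) (ev ψ) := fun φ ψ ↦ hcore φ ψ
  have hnormsq : ∀ φ : W, ‖φ‖ ^ 2 = P (ev φ) (ev φ) := fun φ ↦ by
    rw [← real_inner_self_eq_norm_sq, hinner]
  have hL2le : ∀ φ : W, ∫ x, ev φ x ^ 2 ∂μ ≤ c⁻¹ * ‖φ‖ ^ 2 := fun φ ↦ by
    rw [hnormsq, le_inv_mul_iff₀ hc]
    exact hPcoer (hev1 φ)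
  /- `L²` -/
  have hmemc : ∀ {F : M → ℝ}, Continuous F → MemLp F 2 μ := fun {F} hF ↦
    hF.memLp_of_hasCompactSupport (hcs F)
  have hpair : ∀ {F G : M → ℝ} (hF : Continuous F) (hG : Continuous G),
      ⟪(hmemc hF).toLp F, (hmemc hG).toLp G⟫ = ∫ x, F x * G x ∂μ := by
    intro F G hF hG
    rw [MeasureTheory.L2.inner_def]
    refine integral_congr_ae ?_
    filter_upwards [(hmemc hF).coeFn_toLp, (hmemc hG).coeFn_toLp] with x hx hy
    rw [hx, hy]
    simp [mul_comm]
  have hpairU : ∀ (U : Lp ℝ 2 μ) {G : M → ℝ} (hG : Continuous G),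
      ⟪U, (hmemc hG).toLp G⟫ = ∫ x, U x * G x ∂μ := by
    intro U G hG
    rw [MeasureTheory.L2.inner_def]
    refine integral_congr_ae ?_
    filter_upwards [(hmemc hG).coeFn_toLp] with x hx
    rw [hx]
    simp [mul_comm]
  obtain ⟨T, hT⟩ : ∃ T : W → Lp ℝ 2 μ, ∀ φ, T φ = (hmemc (hevcont φ)).toLp (ev φ) := ⟨_, fun _ ↦ rfl⟩
  have hTsub : ∀ φ ψ : W, T φ - T ψ = T (φ - ψ) := by
    intro φ ψ
    rw [hT, hT, hT, ← MemLp.toLp_sub (hmemc (hevcont φ)) (hmemc (hevcont ψ))]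
    exact MemLp.toLp_congr _ _ (by rw [hev_sub])
  have hTnormsq : ∀ φ : W, ‖T φ‖ ^ 2 = ∫ x, ev φ x ^ 2 ∂μ := fun φ ↦ by
    rw [← real_inner_self_eq_norm_sq, hT, hpair (hevcont φ) (hevcont φ)]
    refine integral_congr_ae (Eventually.of_forall fun x ↦ ?_)
    simp only
    ring
  have hTle : ∀ φ : W, ‖T φ‖ ≤ Real.sqrt c⁻¹ * ‖φ‖ := fun φ ↦ by
    rw [← Real.sqrt_sq (norm_nonneg (T φ)), ← Real.sqrt_sq (norm_nonneg φ), ← Real.sqrt_mul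
      (inv_nonneg.2 hc.le)]
    exact Real.sqrt_le_sqrt ((hTnormsq φ).le.trans (hL2le φ))
  /- the bilinear form and the functional -/
  have hBex : ∃ B₀ : W →L[ℝ] W →L[ℝ] ℝ, ∀ φ ψ, B₀ φ ψ = ⟪φ, ψ⟫ := by
    refine ⟨LinearMap.mkContinuous₂ (LinearMap.mk₂ ℝ (fun φ ψ ↦ ⟪φ, ψ⟫) ?_ ?_ ?_ ?_) 1 ?_,
      fun φ ψ ↦ rfl⟩
    · intro φ ψ χ; exact inner_add_left _ _ _
    · intro a φ χ; exact real_inner_smul_left _ _ _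
    · intro φ ψ χ; exact inner_add_right _ _ _
    · intro a φ χ; exact real_inner_smul_right _ _ _
    · intro φ ψ
      rw [one_mul]
      exact norm_inner_le_norm φ ψ
  obtain ⟨B₀, hB₀⟩ := hBex
  set Cf : ℝ := ‖(hmemc hf).toLp f‖ * Real.sqrt c⁻¹ with hCf
  have hℓ_bound : ∀ ψ : W, |∫ x, f x * ev ψ x ∂μ| ≤ Cf * ‖ψ‖ := by
    intro ψ
    rw [← hpair hf (hevcont ψ), ← hT]
    calc |⟪(hmemc hf).toLp f, T ψ⟫| ≤ ‖(hmemc hf).toLp f‖ * ‖T ψ‖ := abs_real_inner_le_norm _ _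
      _ ≤ ‖(hmemc hf).toLp f‖ * (Real.sqrt c⁻¹ * ‖ψ‖) :=
          mul_le_mul_of_nonneg_left (hTle ψ) (norm_nonneg _)
      _ = Cf * ‖ψ‖ := by rw [hCf]; ring
  have hℓ_int : ∀ ψ : W, Integrable (fun x ↦ f x * ev ψ x) μ := fun ψ ↦
    integrable_of_continuous h (hf.mul (hevcont ψ))
  have hℓex : ∃ ℓ₀ : W →L[ℝ] ℝ, ∀ ψ, ℓ₀ ψ = ∫ x, f x * ev ψ x ∂μ := by
    refine ⟨LinearMap.mkContinuous
      { toFun := fun ψ ↦ ∫ x, f x * ev ψ x ∂μ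
        map_add' := ?_
        map_smul' := ?_ } Cf ?_, fun ψ ↦ rfl⟩
    · intro φ ψ
      rw [hev_add, ← integral_add (hℓ_int φ) (hℓ_int ψ)]
      refine integral_congr_ae (Eventually.of_forall fun x ↦ ?_)
      simp only [Pi.add_apply]; ring
    · intro a ψ
      simp only [RingHom.id_apply, smul_eq_mul]
      rw [hev_smul, ← integral_const_mul]
      refine integral_congr_ae (Eventually.of_forall fun x ↦ ?_)
      simp only [Pi.smul_apply, smul_eq_mul]; ring
    · intro ψ
      simp only [LinearMap.coe_mk, AddHom.coe_mk, Real.norm_eq_abs]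
      exact hℓ_bound ψ
  obtain ⟨ℓ₀, hℓ₀⟩ := hℓex
  /- coercivity (with constant `1`) and Lax–Milgram -/
  have hcoerB : ∀ φ : W, (1 : ℝ) * ‖φ‖ ^ 2 ≤ B₀ φ φ := fun φ ↦ by
    rw [hB₀, real_inner_self_eq_norm_sq, one_mul]
  obtain ⟨v, hvC, hvB, -, -, -⟩ := exists_cauchySeq_tendsto_of_coercive B₀ ℓ₀ one_pos hcoerB
  /- passage to `L²` -/
  have hsc : 0 ≤ Real.sqrt c⁻¹ := Real.sqrt_nonneg _
  have hTC : CauchySeq fun n ↦ T (v n) := by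
    rw [Metric.cauchySeq_iff] at hvC ⊢
    intro ε hε
    obtain ⟨N₀, hN₀⟩ := hvC (ε / (Real.sqrt c⁻¹ + 1)) (by positivity)
    refine ⟨N₀, fun k hk l hl ↦ ?_⟩
    have hkl := hN₀ k hk l hl
    rw [dist_eq_norm] at hkl ⊢
    rw [hTsub]
    calc ‖T (v k - v l)‖ ≤ Real.sqrt c⁻¹ * ‖v k - v l‖ := hTle _
      _ ≤ Real.sqrt c⁻¹ * (ε / (Real.sqrt c⁻¹ + 1)) := mul_le_mul_of_nonneg_left hkl.le hsc
      _ < ε := by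
          rw [mul_div_assoc', div_lt_iff₀ (by positivity)]
          nlinarith
  obtain ⟨U, hU⟩ := cauchySeq_tendsto_of_complete hTC
  refine ⟨U, Lp.memLp U, ?_⟩
  /- the distributional identity -/
  intro ζ hζ
  obtain ⟨φζ, hφζ⟩ := hev_mk ζ hζ
  have hζ1 : ContMDiff (𝓡 m) 𝓘(ℝ, ℝ) 1 ζ := hζ.of_le one_le_two
  have hζcont : Continuous ζ := hζ.continuous
  have hΔc : Continuous (g.dalembertian ζ) := continuous_dalembertian g hζ
  -- the test integrand `χ = V ζ − Δ ζ`
  obtain ⟨χ, hχ⟩ : ∃ χ : M → ℝ, χ = fun x ↦ V x * ζ x - g.dalembertian ζ x := ⟨_, rfl⟩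
  have hχc : Continuous χ := by rw [hχ]; exact (hV.mul hζcont).sub hΔc
  -- `B₀ (v n) φζ = ⟪T (v n), T χ⟫`
  have hBχ : ∀ n, B₀ (v n) φζ = ⟪T (v n), (hmemc hχc).toLp χ⟫ := by
    intro n
    have hGreen := integral_mul_dalembertian_eq_neg_integral_innerDual h (hev1 (v n)) hζ
    rw [hT, hpair (hevcont (v n)) hχc, hB₀, hinner, hP, hφζ]
    have hi1 : Integrable (fun x ↦ ev (v n) x * g.dalembertian ζ x) μ :=
      integrable_of_continuous h ((hevcont (v n)).mul hΔc)
    have hi2 : Integrable (fun x ↦ V x * ev (v n) x * ζ x) μ :=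
      integrable_of_continuous h ((hV.mul (hevcont (v n))).mul hζcont)
    have hI : ∫ x, g.innerDual x (mvfderiv (𝓡 m) (ev (v n)) x).toLinearMap
        (mvfderiv (𝓡 m) ζ x).toLinearMap ∂μ = -∫ x, ev (v n) x * g.dalembertian ζ x ∂μ := by
      rw [hGreen, neg_neg]
    have hχint : ∫ x, ev (v n) x * χ x ∂μ =
        ∫ x, (V x * ev (v n) x * ζ x - ev (v n) x * g.dalembertian ζ x) ∂μ :=
      integral_congr_ae (Eventually.of_forall fun x ↦ by rw [hχ]; simp only; ring)
    rw [hχint, integral_sub hi2 hi1, integral_add (hIint (hev1 (v n)) hζ1) hi2, hI]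
    ring
  have hlim1 : Tendsto (fun n ↦ B₀ (v n) φζ) atTop (𝓝 ⟪U, (hmemc hχc).toLp χ⟫) := by
    simp_rw [hBχ]
    exact hU.inner tendsto_const_nhds
  have hlim2 : Tendsto (fun n ↦ B₀ (v n) φζ) atTop (𝓝 (ℓ₀ φζ)) := hvB φζ
  have heq : ⟪U, (hmemc hχc).toLp χ⟫ = ∫ x, f x * ζ x ∂μ := by
    rw [tendsto_nhds_unique hlim1 hlim2, hℓ₀, hφζ]
  rw [hpairU U hχc] at heq
  calc ∫ x, U x * (g.dalembertian ζ x - V x * ζ x) ∂μ = ∫ x, -(U x * χ x) ∂μ :=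
        integral_congr_ae (Eventually.of_forall fun x ↦ by rw [hχ]; simp only; ring)
    _ = ∫ x, (-f x) * ζ x ∂μ := by
        rw [integral_neg, heq, ← integral_neg]
        exact integral_congr_ae (Eventually.of_forall fun x ↦ by ring)

/-- **Smooth solvability of an `L²`-coercive Schrödinger equation on a closed manifold**
(`dim M ≥ 1`). Let `(M, h)` be a closed Riemannian manifold, `V, f ∈ C^∞(M)`, and suppose
`c ∫ u² dV_h ≤ ∫ (h⁻¹(du, du) + V u²) dV_h` for all `u ∈ C¹(M)` with `c > 0` (the bottom of the
spectrum of `−Δ_h + V` is positive). Then there is `u ∈ C^∞(M)` with `−Δ_h u + V u = f` on `M`: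
the distributional solution of `exists_veryWeakSolution_schrodinger_of_coercive` is smooth by
elliptic regularity (`exists_contMDiffOn_ae_eq_of_veryWeak` with Folland 1995, Cor. (6.34),
`Folland1995_cor634_holds`; patching `exists_contMDiff_ae_eq_of_forall_exists_nhds`) and solves the
equation classically (`dalembertian_sub_mul_eq_of_veryWeak`). Gilbarg–Trudinger 2001, Thm. 8.3
with Thm. 8.13 / Cor. 8.11 (interior regularity), on a closed manifold.
[cite: GilbargTrudinger2001, Thm. 8.3 and Cor. 8.11] [cite: Folland2020, Cor. (6.34)] -/
theorem exists_smooth_solution_schrodinger_of_coercive (hm : 0 < m) {V f : M → ℝ}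
    (hV : ContMDiff (𝓡 m) 𝓘(ℝ, ℝ) ∞ V) (hf : ContMDiff (𝓡 m) 𝓘(ℝ, ℝ) ∞ f) {c : ℝ} (hc : 0 < c)
    (hcoer : ∀ u : M → ℝ, ContMDiff (𝓡 m) 𝓘(ℝ, ℝ) 1 u →
      c * ∫ x, u x ^ 2 ∂riemannianMeasure h ≤
        ∫ x, ((ofRiemannian h).gradSq u x + V x * u x ^ 2) ∂riemannianMeasure h) :
    ∃ u : M → ℝ, ContMDiff (𝓡 m) 𝓘(ℝ, ℝ) ∞ u ∧
      ∀ x, -(ofRiemannian h).dalembertian u x + V x * u x = f x := by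
  classical
  haveI : Nontrivial (EuclideanSpace ℝ (Fin m)) := Module.nontrivial_of_finrank_pos (R := ℝ)
    (by rw [finrank_euclideanSpace_fin]; exact hm)
  haveI : LocallyCompactSpace M := ChartedSpace.locallyCompactSpace (EuclideanSpace ℝ (Fin m)) M
  set μ : Measure M := riemannianMeasure h with hμ
  haveI : IsFiniteMeasure μ := isFiniteMeasure_riemannianMeasure h
  haveI : μ.IsOpenPosMeasure := isOpenPosMeasure_riemannianMeasure h
  have hcs : ∀ F : M → ℝ, HasCompactSupport F := fun F ↦
    IsCompact.of_isClosed_subset isCompact_univ (isClosed_tsupport F) (subset_univ _)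
  -- the `L²` solution
  obtain ⟨U, hU2, hUw⟩ := exists_veryWeakSolution_schrodinger_of_coercive h hV.continuous
    hf.continuous hc hcoer
  -- a measurable representative
  set U' : M → ℝ := hU2.1.mk U with hU'
  have hUU' : U =ᵐ[μ] U' := hU2.1.ae_eq_mk
  have hU'm : Measurable U' := hU2.1.stronglyMeasurable_mk.measurable
  have hU'2 : MemLp U' 2 μ := hU2.ae_eq hUU'
  have hU'li : LocallyIntegrable U' μ := hU'2.locallyIntegrable (by norm_num)
  have hfneg : ContMDiff (𝓡 m) 𝓘(ℝ, ℝ) ∞ (fun x ↦ -f x) := hf.neg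
  have hweak' : ∀ ζ : M → ℝ, ContMDiff (𝓡 m) 𝓘(ℝ, ℝ) 2 ζ → HasCompactSupport ζ →
      ∫ p, U' p * ((ofRiemannian h).dalembertian ζ p - V p * ζ p) ∂μ = ∫ p, (-f p) * ζ p ∂μ := by
    intro ζ hζ _
    rw [← hUw ζ hζ]
    refine integral_congr_ae ?_
    filter_upwards [hUU'] with p hp
    rw [hp]
  -- local smooth representatives and patching
  have hloc := exists_contMDiffOn_ae_eq_of_veryWeak h
    Literature.Analysis.Distribution.Folland1995_cor634_holds hU'm hU'li hV hfneg hweak'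
  obtain ⟨u, hu, hU'u⟩ := exists_contMDiff_ae_eq_of_forall_exists_nhds (m := m) (μ := μ) hloc
  refine ⟨u, hu, fun x ↦ ?_⟩
  -- the classical equation
  have hcl := dalembertian_sub_mul_eq_of_veryWeak h hu hV.continuous hfneg.continuous
    (fun ζ hζ hζc ↦ by
      have hζ2 : ContMDiff (𝓡 m) 𝓘(ℝ, ℝ) 2 ζ := hζ.of_le (WithTop.coe_le_coe.mpr le_top)
      rw [← hweak' ζ hζ2 hζc]
      refine integral_congr_ae ?_
      filter_upwards [hU'u] with p hp
      rw [hp]) x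
  linarith

end Existence

/-! ### The truncation `η_ε(s) = (√(s² + ε²) − s)/2` (a smooth convex regularisation of `s⁻`) -/

section Truncation

/-- `r(s) = √(s² + ε²) > 0` for `ε > 0`. [folklore] -/
private theorem sqrt_sq_add_sq_pos {ε : ℝ} (hε : 0 < ε) (s : ℝ) : 0 < Real.sqrt (s ^ 2 + ε ^ 2) :=
  Real.sqrt_pos.2 (by positivity)

/-- `|s| ≤ √(s² + ε²)` and `ε ≤ √(s² + ε²)`. [folklore] -/
private theorem le_sqrt_sq_add_sq {ε : ℝ} (hε : 0 < ε) (s : ℝ) :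
    |s| ≤ Real.sqrt (s ^ 2 + ε ^ 2) ∧ ε ≤ Real.sqrt (s ^ 2 + ε ^ 2) := by
  constructor
  · rw [← Real.sqrt_sq_eq_abs]
    exact Real.sqrt_le_sqrt (by nlinarith)
  · conv_lhs => rw [← Real.sqrt_sq hε.le]
    exact Real.sqrt_le_sqrt (by nlinarith)

/-- The derivative of `r(s) = √(s² + ε²)` is `s / r(s)`. [folklore] -/
private theorem hasDerivAt_sqrt_sq_add_sq {ε : ℝ} (hε : 0 < ε) (s : ℝ) :
    HasDerivAt (fun t ↦ Real.sqrt (t ^ 2 + ε ^ 2)) (s / Real.sqrt (s ^ 2 + ε ^ 2)) s := by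
  have h1 : HasDerivAt (fun t ↦ t ^ 2 + ε ^ 2) (2 * s) s := by
    simpa using (hasDerivAt_pow 2 s).add_const (ε ^ 2)
  have h2 := h1.sqrt (by positivity : s ^ 2 + ε ^ 2 ≠ 0)
  convert h2 using 1
  field_simp

/-- **The truncation functions.** For `ε > 0` put `r(s) = √(s² + ε²)`, `η(s) = (r(s) − s)/2` and
`G(s) = −η(s)²/r(s)` (`= η η'`). Then: `η` and `G` are `C¹` with `η' = −η/r`,
`G' = η²(2r + s)/r³ ≥ η'²`; `η ≥ max(−s, 0) ≥ 0`, `G ≤ 0`; and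
`0 ≤ η² − s G = η (η − s η') ≤ (ε/2) η`. These are the properties of the convex regularisation of
`s⁻` used in the truncation (Stampacchia) argument below. [folklore] -/
private theorem truncation_facts {ε : ℝ} (hε : 0 < ε) :
    ∃ η G dη dG : ℝ → ℝ,
      (∀ s, HasDerivAt η (dη s) s) ∧ (∀ s, HasDerivAt G (dG s) s) ∧
      Continuous dη ∧ Continuous dG ∧
      (∀ s, dη s ^ 2 ≤ dG s) ∧ (∀ s, 0 ≤ η s) ∧ (∀ s, max (-s) 0 ≤ η s) ∧ (∀ s, G s ≤ 0) ∧
      (∀ s, 0 ≤ η s ^ 2 - s * G s) ∧ (∀ s, η s ^ 2 - s * G s ≤ ε / 2 * η s) ∧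
      ContDiff ℝ 2 η ∧ ContDiff ℝ 2 G := by
  set r : ℝ → ℝ := fun s ↦ Real.sqrt (s ^ 2 + ε ^ 2) with hr
  have hrpos : ∀ s, 0 < r s := sqrt_sq_add_sq_pos hε
  have hrabs : ∀ s, |s| ≤ r s := fun s ↦ (le_sqrt_sq_add_sq hε s).1
  have hrε : ∀ s, ε ≤ r s := fun s ↦ (le_sqrt_sq_add_sq hε s).2
  have hrsq : ∀ s, r s ^ 2 = s ^ 2 + ε ^ 2 := fun s ↦ Real.sq_sqrt (by positivity)
  have hrd : ∀ s, HasDerivAt r (s / r s) s := hasDerivAt_sqrt_sq_add_sq hε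
  set η : ℝ → ℝ := fun s ↦ (r s - s) / 2 with hη
  set G : ℝ → ℝ := fun s ↦ -(η s ^ 2 / r s) with hG
  set dη : ℝ → ℝ := fun s ↦ (s / r s - 1) / 2 with hdη
  set dG : ℝ → ℝ := fun s ↦ -((2 * η s * dη s * r s - η s ^ 2 * (s / r s)) / r s ^ 2) with hdG
  have hηd : ∀ s, HasDerivAt η (dη s) s := fun s ↦ by
    have := ((hrd s).sub (hasDerivAt_id s)).div_const 2
    simpa [hη, hdη] using this
  have hGd : ∀ s, HasDerivAt G (dG s) s := fun s ↦ by
    have h1 : HasDerivAt (fun t ↦ η t ^ 2) (2 * η s * dη s) s := by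
      refine ((hηd s).pow 2).congr_deriv ?_
      push_cast
      ring
    exact (h1.div (hrd s) (hrpos s).ne').neg
  have hηnn : ∀ s, max (-s) 0 ≤ η s := fun s ↦ by
    have h1 := hrabs s
    have h2 : -s ≤ |s| := neg_le_abs s
    have h3 : s ≤ |s| := le_abs_self s
    simp only [hη, max_le_iff]
    constructor <;> linarith
  have hη0 : ∀ s, 0 ≤ η s := fun s ↦ (le_max_right _ _).trans (hηnn s)
  have hrcont : Continuous r := by
    rw [hr]; exact (continuous_pow 2 |>.add continuous_const).sqrt
  have hηcont : Continuous η := by rw [hη]; exact (hrcont.sub continuous_id).div_const 2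
  have hdηcont : Continuous dη := by
    rw [hdη]
    exact ((continuous_id.div hrcont fun s ↦ (hrpos s).ne').sub continuous_const).div_const 2
  have hdGcont : Continuous dG := by
    rw [hdG]
    refine (Continuous.div ?_ (hrcont.pow 2) fun s ↦ pow_ne_zero 2 (hrpos s).ne').neg
    exact ((continuous_const.mul hηcont).mul hdηcont |>.mul hrcont).sub
      ((hηcont.pow 2).mul (continuous_id.div hrcont fun s ↦ (hrpos s).ne'))
  -- the algebraic identities: `η' = −η/r`, `G' = η²(2r+s)/r³`, `η² − sG = η²(r+s)/r`
  have hr0 : ∀ s, r s ≠ 0 := fun s ↦ (hrpos s).ne'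
  have hdη' : ∀ s, dη s = -(η s / r s) := fun s ↦ by
    have := hr0 s
    simp only [hdη, hη]
    field_simp
    ring
  have hdG' : ∀ s, dG s = η s ^ 2 * (2 * r s + s) / r s ^ 3 := fun s ↦ by
    have := hr0 s
    simp only [hdG, hdη']
    field_simp
    ring
  have hkey : ∀ s, η s ^ 2 - s * G s = η s ^ 2 * (r s + s) / r s := fun s ↦ by
    have := hr0 s
    simp only [hG]
    field_simp
    ring
  have hrs : ∀ s, 0 ≤ r s + s := fun s ↦ by linarith [hrabs s, neg_le_abs s]
  have hrC : ContDiff ℝ 2 r := by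
    rw [hr]
    exact ContDiff.sqrt (contDiff_id.pow 2 |>.add contDiff_const) fun s ↦ by positivity
  have hηC : ContDiff ℝ 2 η := by
    rw [hη]
    exact (hrC.sub contDiff_id).div_const 2
  have hGC : ContDiff ℝ 2 G := by
    rw [hG]
    exact ((hηC.pow 2).div hrC hr0).neg
  refine ⟨η, G, dη, dG, hηd, hGd, hdηcont, hdGcont, fun s ↦ ?_, hη0, hηnn, fun s ↦ ?_,
    fun s ↦ ?_, fun s ↦ ?_, hηC, hGC⟩
  · -- `η'² ≤ G'`: `G' − η'² = η²(r + s)/r³ ≥ 0`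
    rw [hdη', hdG', neg_pow, show (-1 : ℝ) ^ 2 = 1 by norm_num, one_mul, div_pow]
    rw [div_le_div_iff₀ (pow_pos (hrpos s) 2) (pow_pos (hrpos s) 3)]
    nlinarith [hrs s, sq_nonneg (η s), pow_pos (hrpos s) 2, mul_nonneg (sq_nonneg (η s)) (hrs s),
      mul_nonneg (mul_nonneg (sq_nonneg (η s)) (hrs s)) (pow_pos (hrpos s) 2).le]
  · -- `G ≤ 0`
    simp only [hG, neg_nonpos]
    exact div_nonneg (sq_nonneg _) (hrpos s).le
  · rw [hkey]
    exact div_nonneg (mul_nonneg (sq_nonneg _) (hrs s)) (hrpos s).le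
  · -- `η²(r+s)/r = η (r² − s²)/(2r) = η ε²/(2r) ≤ η ε/2`
    rw [hkey]
    have h1 : η s * (r s + s) = ε ^ 2 / 2 := by
      simp only [hη]
      nlinarith [hrsq s]
    rw [show η s ^ 2 * (r s + s) / r s = η s * (η s * (r s + s)) / r s by ring, h1,
      div_le_iff₀ (hrpos s)]
    nlinarith [mul_nonneg (mul_nonneg (hη0 s) hε.le) (sub_nonneg.2 (hrε s))]

end Truncation

section Positivity

variable {m : ℕ} {M : Type*} [TopologicalSpace M] [T2Space M] [CompactSpace M]
  [ChartedSpace (EuclideanSpace ℝ (Fin m)) M] [IsManifold (𝓡 m) ∞ M]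
  [MeasurableSpace M] [BorelSpace M]
  (h : ContMDiffRiemannianMetric (𝓡 m) ∞ (EuclideanSpace ℝ (Fin m)) (TangentSpace (𝓡 m) : M → Type _))
  [(ofRiemannian h).HasLeviCivita]

/-- **Nonnegativity of solutions of a coercive Schrödinger equation with nonnegative source**
(the weak minimum principle from `λ₁ > 0`, by Stampacchia truncation). On a closed Riemannian
manifold let `V` be continuous with `c ∫ w² dV_h ≤ ∫ (h⁻¹(dw,dw) + V w²) dV_h` for all
`w ∈ C¹(M)` (`c > 0`), and let `u ∈ C²(M)` solve `−Δ_h u + V u = f` with `f ≥ 0`. Then `u ≥ 0`.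
Proof: test the coercivity with `w = η_ε(u)`, `η_ε(s) = (√(s²+ε²) − s)/2` a smooth convex
regularisation of `s⁻`, and the equation with `η_ε(u)η_ε'(u) ≤ 0` (Green's identity
`∫ G(u) Δ_h u = −∫ G'(u) |∇u|²`): this gives `c ∫ η_ε(u)² ≤ (ε/2) ∫ |V| η_ε(u)`, whence
`∫ (u⁻)² ≤ ∫ η_ε(u)² ≤ ε² ∫V²/(4c²)` for every `ε > 0`, so `u⁻ = 0`. (Gilbarg–Trudinger 2001,
Thm. 8.1 and its proof, the case of a coercive form on a closed manifold.)
[cite: GilbargTrudinger2001, Thm. 8.1] -/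
theorem nonneg_of_schrodinger_eq_of_coercive {V f u : M → ℝ} (hV : Continuous V)
    (hf0 : ∀ x, 0 ≤ f x) {c : ℝ} (hc : 0 < c)
    (hcoer : ∀ w : M → ℝ, ContMDiff (𝓡 m) 𝓘(ℝ, ℝ) 1 w →
      c * ∫ x, w x ^ 2 ∂riemannianMeasure h ≤
        ∫ x, ((ofRiemannian h).gradSq w x + V x * w x ^ 2) ∂riemannianMeasure h)
    (hu : ContMDiff (𝓡 m) 𝓘(ℝ, ℝ) 2 u)
    (hpde : ∀ x, -(ofRiemannian h).dalembertian u x + V x * u x = f x) : ∀ x, 0 ≤ u x := by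
  classical
  set g := ofRiemannian h with hg_def
  set μ : Measure M := riemannianMeasure h with hμ
  haveI : IsFiniteMeasure μ := isFiniteMeasure_riemannianMeasure h
  haveI : μ.IsOpenPosMeasure := isOpenPosMeasure_riemannianMeasure h
  have hgR : g.IsRiemannian := isRiemannian_ofRiemannian h
  have hu1 : ContMDiff (𝓡 m) 𝓘(ℝ, ℝ) 1 u := hu.of_le one_le_two
  have hucont : Continuous u := hu.continuous
  have hΔc : Continuous (g.dalembertian u) := continuous_dalembertian g hu
  have hfcont : Continuous f := by
    have : f = fun x ↦ -(ofRiemannian h).dalembertian u x + V x * u x := funext fun x ↦ (hpde x).symm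
    rw [this]; exact hΔc.neg.add (hV.mul hucont)
  have hgrad0 : ∀ x, 0 ≤ g.gradSq u x := fun x ↦ innerDual_self_nonneg h x _
  have hgradc : Continuous (g.gradSq u) := continuous_innerDual_mvfderiv g hu1 hu1
  -- `∫ (u⁻)² ≤ ε² K` for every `ε > 0`
  set K : ℝ := (∫ x, V x ^ 2 ∂μ) / (4 * c ^ 2) with hK
  have hmain : ∀ ε : ℝ, 0 < ε → ∫ x, max (-u x) 0 ^ 2 ∂μ ≤ ε ^ 2 * K := by
    intro ε hε
    obtain ⟨η, G, dη, dG, hηd, hGd, hdηc, -, hdd, hη0, hηneg, hG0, hkey0, hkeyε, hηC2, hGC2⟩ :=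
      truncation_facts hε
    have hηc : Continuous η := hηC2.continuous
    have hGc : Continuous G := continuous_iff_continuousAt.2 fun s ↦ (hGd s).continuousAt
    have hηdiff : ∀ s, DifferentiableAt ℝ η s := fun s ↦ (hηd s).differentiableAt
    have hGdiff : ∀ s, DifferentiableAt ℝ G s := fun s ↦ (hGd s).differentiableAt
    have hderη : ∀ s, deriv η s = dη s := fun s ↦ (hηd s).deriv
    have hderG : ∀ s, deriv G s = dG s := fun s ↦ (hGd s).deriv
    -- the test functions `w = η ∘ u ∈ C²`, `G ∘ u ∈ C¹`
    have hw2 : ContMDiff (𝓡 m) 𝓘(ℝ, ℝ) 2 (η ∘ u) := hηC2.contMDiff.comp hu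
    have hw1 : ContMDiff (𝓡 m) 𝓘(ℝ, ℝ) 1 (η ∘ u) := hw2.of_le one_le_two
    have hGu1 : ContMDiff (𝓡 m) 𝓘(ℝ, ℝ) 1 (G ∘ u) := (hGC2.contMDiff.comp hu).of_le one_le_two
    have hdGc : Continuous fun x ↦ dG (u x) := by
      have : (fun x ↦ dG (u x)) = fun x ↦ deriv G (u x) := funext fun x ↦ (hderG (u x)).symm
      rw [this]
      exact (hGC2.continuous_deriv (by norm_num)).comp hucont
    -- chain rules
    have hgradw : ∀ x, g.gradSq (η ∘ u) x = dη (u x) ^ 2 * g.gradSq u x := fun x ↦ by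
      have hd : mvfderiv (𝓡 m) (η ∘ u) x = dη (u x) • mvfderiv (𝓡 m) u x := by
        ext v
        rw [mvfderiv_real_comp (hηdiff _) ((hu1 x).mdifferentiableAt one_ne_zero) v, hderη]
        rfl
      simp only [PseudoRiemannianMetric.gradSq, PseudoRiemannianMetric.innerDual, hd,
        ContinuousLinearMap.toLinearMap_smul, map_smul, LinearMap.smul_apply, smul_eq_mul]
      ring
    have hgradG : ∀ x, g.innerDual x (mvfderiv (𝓡 m) (G ∘ u) x).toLinearMap
        (mvfderiv (𝓡 m) u x).toLinearMap = dG (u x) * g.gradSq u x := fun x ↦ by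
      have hd : mvfderiv (𝓡 m) (G ∘ u) x = dG (u x) • mvfderiv (𝓡 m) u x := by
        ext v
        rw [mvfderiv_real_comp (hGdiff _) ((hu1 x).mdifferentiableAt one_ne_zero) v, hderG]
        rfl
      simp only [PseudoRiemannianMetric.gradSq, PseudoRiemannianMetric.innerDual, hd,
        ContinuousLinearMap.toLinearMap_smul, LinearMap.smul_apply, smul_eq_mul]
    -- (1) coercivity tested on `w`
    have h1 := hcoer (η ∘ u) hw1
    -- (2) the equation tested on `G(u)`: `∫ G'(u)|∇u|² + ∫ V u G(u) = ∫ f G(u) ≤ 0`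
    have hGreen := integral_mul_dalembertian_eq_neg_integral_innerDual h hGu1 hu
    have hiGΔ : Integrable (fun x ↦ (G ∘ u) x * g.dalembertian u x) μ :=
      integrable_of_continuous h ((hGc.comp hucont).mul hΔc)
    have hidG : Integrable (fun x ↦ dG (u x) * g.gradSq u x) μ :=
      integrable_of_continuous h (hdGc.mul hgradc)
    have hiVuG : Integrable (fun x ↦ V x * u x * G (u x)) μ :=
      integrable_of_continuous h ((hV.mul hucont).mul (hGc.comp hucont))
    have hifG : Integrable (fun x ↦ f x * G (u x)) μ :=
      integrable_of_continuous h (hfcont.mul (hGc.comp hucont))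
    have h2 : ∫ x, dG (u x) * g.gradSq u x ∂μ + ∫ x, V x * u x * G (u x) ∂μ ≤ 0 := by
      have hfG : ∫ x, f x * G (u x) ∂μ ≤ 0 :=
        integral_nonpos fun x ↦ mul_nonpos_of_nonneg_of_nonpos (hf0 x) (hG0 _)
      have heq : ∫ x, f x * G (u x) ∂μ =
          ∫ x, dG (u x) * g.gradSq u x ∂μ + ∫ x, V x * u x * G (u x) ∂μ := by
        have hGΔ : ∫ x, (G ∘ u) x * g.dalembertian u x ∂μ = -∫ x, dG (u x) * g.gradSq u x ∂μ := by
          rw [hGreen]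
          congr 1
          exact integral_congr_ae (Eventually.of_forall fun x ↦ hgradG x)
        have hpt : (fun x ↦ f x * G (u x)) =
            fun x ↦ V x * u x * G (u x) - (G ∘ u) x * g.dalembertian u x :=
          funext fun x ↦ by simp only [Function.comp_apply]; rw [← hpde x]; ring
        rw [hpt, integral_sub hiVuG hiGΔ, hGΔ]
        ring
      linarith
    -- (3) `∫ η'(u)² |∇u|² ≤ ∫ G'(u) |∇u|²`
    have hidη : Integrable (fun x ↦ dη (u x) ^ 2 * g.gradSq u x) μ :=
      integrable_of_continuous h (((hdηc.comp hucont).pow 2).mul hgradc)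
    have h3 : ∫ x, dη (u x) ^ 2 * g.gradSq u x ∂μ ≤ ∫ x, dG (u x) * g.gradSq u x ∂μ :=
      integral_mono hidη hidG fun x ↦ mul_le_mul_of_nonneg_right (hdd _) (hgrad0 x)
    -- (4) assemble: `c ∫ η(u)² ≤ ∫ V (η(u)² − u G(u)) ≤ (ε/2) ∫ |V| η(u)`
    have hiη2 : Integrable (fun x ↦ (η ∘ u) x ^ 2) μ :=
      integrable_of_continuous h ((hηc.comp hucont).pow 2)
    have hiVη2 : Integrable (fun x ↦ V x * (η ∘ u) x ^ 2) μ :=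
      integrable_of_continuous h (hV.mul ((hηc.comp hucont).pow 2))
    have higradw : Integrable (fun x ↦ g.gradSq (η ∘ u) x) μ :=
      integrable_of_continuous h (continuous_innerDual_mvfderiv g hw1 hw1)
    have hsplit : ∫ x, (g.gradSq (η ∘ u) x + V x * (η ∘ u) x ^ 2) ∂μ =
        ∫ x, dη (u x) ^ 2 * g.gradSq u x ∂μ + ∫ x, V x * (η ∘ u) x ^ 2 ∂μ := by
      rw [integral_add higradw hiVη2]
      congr 1
      exact integral_congr_ae (Eventually.of_forall fun x ↦ hgradw x)
    have hiAM : Integrable (fun x ↦ c / 2 * (η ∘ u) x ^ 2 + ε ^ 2 / (8 * c) * V x ^ 2) μ :=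
      integrable_of_continuous h ((continuous_const.mul ((hηc.comp hucont).pow 2)).add
        (continuous_const.mul (hV.pow 2)))
    have h4 : ∫ x, V x * (η ∘ u) x ^ 2 ∂μ - ∫ x, V x * u x * G (u x) ∂μ ≤
        ∫ x, (c / 2 * (η ∘ u) x ^ 2 + ε ^ 2 / (8 * c) * V x ^ 2) ∂μ := by
      rw [← integral_sub hiVη2 hiVuG]
      refine integral_mono (hiVη2.sub hiVuG) hiAM fun x ↦ ?_
      simp only [Function.comp_apply]
      have hk0 := hkey0 (u x)
      have hkε := hkeyε (u x)
      have hηx := hη0 (u x)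
      -- `V (η² − uG) ≤ |V| (ε/2) η ≤ (c/2) η² + ε² V²/(8c)`
      have hA : V x * η (u x) ^ 2 - V x * u x * G (u x) = V x * (η (u x) ^ 2 - u x * G (u x)) := by
        ring
      rw [hA]
      have hB : V x * (η (u x) ^ 2 - u x * G (u x)) ≤ |V x| * (ε / 2 * η (u x)) :=
        (le_abs_self _).trans (by rw [abs_mul, abs_of_nonneg hk0]; gcongr)
      refine hB.trans ?_
      have hq : ε ^ 2 / (8 * c) * V x ^ 2 * (8 * c) = (ε * |V x|) ^ 2 := by
        rw [mul_pow, sq_abs]; field_simp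
      nlinarith [sq_nonneg (2 * c * η (u x) - ε * |V x|), hq, hc, abs_nonneg (V x), hηx]
    have h5 : c * ∫ x, (η ∘ u) x ^ 2 ∂μ ≤
        c / 2 * ∫ x, (η ∘ u) x ^ 2 ∂μ + ε ^ 2 / (8 * c) * ∫ x, V x ^ 2 ∂μ := by
      have := h1
      rw [hsplit] at this
      have h6 : ∫ x, (c / 2 * (η ∘ u) x ^ 2 + ε ^ 2 / (8 * c) * V x ^ 2) ∂μ =
          c / 2 * ∫ x, (η ∘ u) x ^ 2 ∂μ + ε ^ 2 / (8 * c) * ∫ x, V x ^ 2 ∂μ := by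
        have hiV2 : Integrable (fun x ↦ V x ^ 2) μ := integrable_of_continuous h (hV.pow 2)
        rw [integral_add (hiη2.const_mul (c / 2)) (hiV2.const_mul (ε ^ 2 / (8 * c))),
          integral_const_mul, integral_const_mul]
      linarith
    -- (5) `(u⁻)² ≤ η(u)²`
    have hi_neg : Integrable (fun x ↦ max (-u x) 0 ^ 2) μ :=
      integrable_of_continuous h ((hucont.neg.max continuous_const).pow 2)
    have h7 : ∫ x, max (-u x) 0 ^ 2 ∂μ ≤ ∫ x, (η ∘ u) x ^ 2 ∂μ :=
      integral_mono hi_neg hiη2 fun x ↦ pow_le_pow_left₀ (le_max_right _ _) (hηneg (u x)) 2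
    have h8 : ∫ x, (η ∘ u) x ^ 2 ∂μ ≤ ε ^ 2 * K := by
      rw [hK]
      have hc2 : (0 : ℝ) < c / 2 := by positivity
      have : c / 2 * ∫ x, (η ∘ u) x ^ 2 ∂μ ≤ ε ^ 2 / (8 * c) * ∫ x, V x ^ 2 ∂μ := by linarith
      rw [show ε ^ 2 * ((∫ x, V x ^ 2 ∂μ) / (4 * c ^ 2)) =
        (ε ^ 2 / (8 * c) * ∫ x, V x ^ 2 ∂μ) / (c / 2) by field_simp; ring]
      rwa [le_div_iff₀ hc2, mul_comm]
    exact h7.trans h8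
  -- hence `∫ (u⁻)² = 0` and `u⁻ ≡ 0`
  have hK0 : 0 ≤ K := div_nonneg (integral_nonneg fun x ↦ sq_nonneg _) (by positivity)
  have hI0 : ∫ x, max (-u x) 0 ^ 2 ∂μ ≤ 0 := by
    refine le_of_forall_pos_le_add fun δ hδ ↦ ?_
    rw [zero_add]
    obtain ⟨ε, hε, hεK⟩ : ∃ ε : ℝ, 0 < ε ∧ ε ^ 2 * K ≤ δ := by
      refine ⟨min 1 (δ / (K + 1)), by positivity, ?_⟩
      have hm1 : min 1 (δ / (K + 1)) ≤ 1 := min_le_left _ _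
      have hm2 : min 1 (δ / (K + 1)) ≤ δ / (K + 1) := min_le_right _ _
      have hm0 : 0 ≤ min 1 (δ / (K + 1)) := by positivity
      calc min 1 (δ / (K + 1)) ^ 2 * K ≤ (1 * (δ / (K + 1))) * K := by
            rw [sq]; gcongr
        _ ≤ δ := by
            rw [one_mul, div_mul_eq_mul_div, div_le_iff₀ (by positivity)]
            nlinarith
    exact (hmain ε hε).trans hεK
  have hIeq : ∫ x, max (-u x) 0 ^ 2 ∂μ = 0 :=
    le_antisymm hI0 (integral_nonneg fun x ↦ sq_nonneg _)
  have hcneg : Continuous fun x ↦ max (-u x) 0 ^ 2 := (hucont.neg.max continuous_const).pow 2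
  have hae := (integral_eq_zero_iff_of_nonneg (fun x ↦ sq_nonneg _)
    (integrable_of_continuous h hcneg)).1 hIeq
  have hfun : (fun x ↦ max (-u x) 0 ^ 2) = fun _ ↦ (0 : ℝ) :=
    (Continuous.ae_eq_iff_eq μ hcneg continuous_const).1 hae
  intro x
  have hx := congr_fun hfun x
  simp only [ne_eq, OfNat.ofNat_ne_zero, not_false_eq_true, pow_eq_zero_iff, max_eq_right_iff,
    neg_nonpos] at hx
  exact hx

omit [T2Space M] [CompactSpace M] [MeasurableSpace M] [BorelSpace M] in
/-- **Strict positivity** (E. Hopf): if moreover the source is positive, `f > 0`, then a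
nonnegative `C²` solution of `−Δ_h u + V u = f` is positive — at a zero `x₀` of `u ≥ 0` the local
strong minimum principle (`dalembertian_supersolution_eventually_eq`, López-Gómez 2012, Thm. 1.2,
applied to `Δ_h u = V u − f ≤ |V| u`) makes `u` vanish near `x₀`, so `Δ_h u(x₀) = 0` and
`f(x₀) = 0`. [cite: LopezGomez2012, Thm. 1.2] [cite: GilbargTrudinger2001, Thm. 3.5] -/
theorem pos_of_schrodinger_eq_of_nonneg {V f u : M → ℝ} (hV : Continuous V) (hfpos : ∀ x, 0 < f x)
    (hu : ContMDiff (𝓡 m) 𝓘(ℝ, ℝ) 2 u) (hu0 : ∀ x, 0 ≤ u x)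
    (hpde : ∀ x, -(ofRiemannian h).dalembertian u x + V x * u x = f x) : ∀ x, 0 < u x := by
  set g := ofRiemannian h with hg_def
  have hgR : g.IsRiemannian := isRiemannian_ofRiemannian h
  by_contra hcon
  push Not at hcon
  obtain ⟨x₀, hx₀⟩ := hcon
  have hux₀ : u x₀ = 0 := le_antisymm hx₀ (hu0 x₀)
  have hpde' : ∀ x, g.dalembertian u x ≤ |V x| * u x := fun x ↦ by
    have h1 := hpde x
    have h2 : V x * u x ≤ |V x| * u x := mul_le_mul_of_nonneg_right (le_abs_self _) (hu0 x)
    linarith [hfpos x]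
  have hev := g.dalembertian_supersolution_eventually_eq hgR (continuous_abs.comp hV)
    (fun x ↦ abs_nonneg _) hu hpde' le_rfl hu0 hux₀
  have hΔ0 : g.dalembertian u x₀ = 0 :=
    g.dalembertian_eq_zero_of_eventuallyEq_zero (hev.mono fun x hx ↦ hx)
  have := hpde x₀
  rw [hΔ0, hux₀] at this
  linarith [hfpos x₀]

/-- **A positive first eigenvalue gives a positive strict supersolution** (the direction
"`λ₁(−Δ + V) > 0 ⇒` there is `u > 0` with `(−Δ + V)u > 0`"; Kazdan–Warner / Gursky–LeBrun 1998,
Prop. 3, for the conformal and modified-conformal Laplacians). On a closed Riemannian manifold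
of dimension `≥ 1`, if `V` is continuous and `c ∫ w² ≤ ∫ (h⁻¹(dw,dw) + V w²)` for all
`w ∈ C¹(M)` with `c > 0`, then there is a smooth `u > 0` with `−Δ_h u + V u > 0` everywhere.
Proof: choose `Ṽ ∈ C^∞` with `V − c/2 ≤ Ṽ ≤ V` (smooth partitions of unity,
`exists_contMDiffMap_forall_mem_convex_of_local_const`); the form of `−Δ + Ṽ` is coercive with
constant `c/2`; solve `−Δ_h u + Ṽ u = 1` smoothly (`exists_smooth_solution_schrodinger_of_coercive`);
`u ≥ 0` (`nonneg_of_schrodinger_eq_of_coercive`), `u > 0` (`pos_of_schrodinger_eq_of_nonneg`),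
and `−Δ_h u + V u = 1 + (V − Ṽ) u ≥ 1`. [cite: GurskyLebrun1998, Prop. 3]
[cite: GilbargTrudinger2001, Thm. 8.3] -/
theorem exists_pos_smooth_supersolution_of_coercive (hm : 0 < m) {V : M → ℝ} (hV : Continuous V)
    {c : ℝ} (hc : 0 < c)
    (hcoer : ∀ w : M → ℝ, ContMDiff (𝓡 m) 𝓘(ℝ, ℝ) 1 w →
      c * ∫ x, w x ^ 2 ∂riemannianMeasure h ≤
        ∫ x, ((ofRiemannian h).gradSq w x + V x * w x ^ 2) ∂riemannianMeasure h) :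
    ∃ u : M → ℝ, ContMDiff (𝓡 m) 𝓘(ℝ, ℝ) ∞ u ∧ (∀ x, 0 < u x) ∧
      ∀ x, 0 < -(ofRiemannian h).dalembertian u x + V x * u x := by
  classical
  set g := ofRiemannian h with hg_def
  set μ : Measure M := riemannianMeasure h with hμ
  haveI : IsFiniteMeasure μ := isFiniteMeasure_riemannianMeasure h
  -- a smooth `Ṽ` with `V − c/2 ≤ Ṽ ≤ V`
  obtain ⟨Vs, hVs⟩ := exists_contMDiffMap_forall_mem_convex_of_local_const (𝓡 m) (n := ⊤)
    (F := ℝ) (t := fun x ↦ Icc (V x - c / 2) (V x)) (fun x ↦ convex_Icc _ _) (fun x ↦ by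
      refine ⟨V x - c / 4, ?_⟩
      have h1 : ∀ᶠ y in 𝓝 x, dist (V y) (V x) < c / 4 :=
        (Metric.tendsto_nhds.1 (hV.tendsto x)) (c / 4) (by positivity)
      filter_upwards [h1] with y hy
      rw [Real.dist_eq, abs_lt] at hy
      constructor <;> linarith [hy.1, hy.2])
  set Vt : M → ℝ := ⇑Vs with hVt
  have hVt : ContMDiff (𝓡 m) 𝓘(ℝ, ℝ) ∞ Vt := Vs.contMDiff
  have hVt1 : ∀ x, V x - c / 2 ≤ Vt x := fun x ↦ (hVs x).1
  have hVt2 : ∀ x, Vt x ≤ V x := fun x ↦ (hVs x).2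
  -- coercivity for `Ṽ` with constant `c/2`
  have hcoer' : ∀ w : M → ℝ, ContMDiff (𝓡 m) 𝓘(ℝ, ℝ) 1 w →
      c / 2 * ∫ x, w x ^ 2 ∂μ ≤ ∫ x, (g.gradSq w x + Vt x * w x ^ 2) ∂μ := by
    intro w hw
    have h1 := hcoer w hw
    have hwc : Continuous w := hw.continuous
    have hi1 : Integrable (fun x ↦ g.gradSq w x + V x * w x ^ 2) μ :=
      integrable_of_continuous h ((continuous_innerDual_mvfderiv g hw hw).add (hV.mul (hwc.pow 2)))
    have hi2 : Integrable (fun x ↦ g.gradSq w x + Vt x * w x ^ 2) μ :=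
      integrable_of_continuous h ((continuous_innerDual_mvfderiv g hw hw).add
        (hVt.continuous.mul (hwc.pow 2)))
    have hi3 : Integrable (fun x ↦ w x ^ 2) μ := integrable_of_continuous h (hwc.pow 2)
    have h2 : ∫ x, (g.gradSq w x + V x * w x ^ 2) ∂μ - c / 2 * ∫ x, w x ^ 2 ∂μ ≤
        ∫ x, (g.gradSq w x + Vt x * w x ^ 2) ∂μ := by
      rw [← integral_const_mul, ← integral_sub hi1 (hi3.const_mul _)]
      refine integral_mono (hi1.sub (hi3.const_mul _)) hi2 fun x ↦ ?_
      simp only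
      nlinarith [hVt1 x, sq_nonneg (w x)]
    linarith
  -- solve `−Δ u + Ṽ u = 1`
  obtain ⟨u, hu, hpde⟩ := exists_smooth_solution_schrodinger_of_coercive h hm hVt contMDiff_const
    (half_pos hc) hcoer' (f := fun _ ↦ (1 : ℝ))
  have hu2 : ContMDiff (𝓡 m) 𝓘(ℝ, ℝ) 2 u := hu.of_le (WithTop.coe_le_coe.mpr le_top)
  have hu0 : ∀ x, 0 ≤ u x := nonneg_of_schrodinger_eq_of_coercive h hVt.continuous
    (fun _ ↦ zero_le_one) (half_pos hc) hcoer' hu2 hpde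
  have hupos : ∀ x, 0 < u x := pos_of_schrodinger_eq_of_nonneg h hVt.continuous
    (fun _ ↦ one_pos) hu2 hu0 hpde
  refine ⟨u, hu, hupos, fun x ↦ ?_⟩
  have h1 := hpde x
  have h2 : Vt x * u x ≤ V x * u x := mul_le_mul_of_nonneg_right (hVt2 x) (hu0 x)
  linarith

end Positivity

end Literature.Geometry.Riemannian
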